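import Mathlib
import Summits.ResolutionOfSingularities.ResolutionOfSingularities.Theorems.TropicalLinksInductiveStepWeightZero

/-!
# TropicalLinks / InductiveStep — the concrete charts of the projective closure are regular

Route `ResolutionOfSingularities/TropicalLinks`, crux `InductiveStep` (stmt-ResolutionOfSingularities-17233),
line `split`, producer brick DTa (transfer of chart regularity from the datum to the chart subalgebras
of the fraction field), in support of stub `stub_valuativeCharts`.

Setting: `B` is a domain, finitely generated over the field `k` by `f₁ … f_n` (the evaluation
`MvPolynomial.aeval f : k[X₁ … X_n] → B` is surjective), `K = Frac B`. Write `f' := Fin.cons 1 f`, so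
`f'₀ = 1` and `f'_{i+1} = fᵢ`. The datum of the child `SncClosureSchon` hands the line the affine charts
of the projective closure `Ȳ ⊆ ℙⁿ` of `Spec B` ABSTRACTLY:

* chart `0` is `B` itself, assumed regular at all primes;
* chart `i + 1` (`= D₊(X_{i+1})`) is `C_i := k[X₀ … X_n] ⧸ ker (X₀ ↦ 1/fᵢ, X_{j+1} ↦ fⱼ/fᵢ)`, the
  evaluation taking values in `Localization.Away (f i)`, assumed regular at all primes.

The producer works instead with the CONCRETE chart subalgebras
`𝒞_h := k[f'_j / f'_h : j] ⊆ K`. This file proves (`tropicalLinks_projChart_regular`) that every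
`𝒞_h` with `f'_h ≠ 0` is regular at all its primes:

* `h = 0`: `𝒞₀ = k[f_j] = im (B → K) ≅ B` (the map `B → K` is injective);
* `h = i + 1`: the lift `φ : B[fᵢ⁻¹] → K` of `B → K` is injective (`B` is a domain, `fᵢ ≠ 0`) and sends
  the generators `1/fᵢ, fⱼ/fᵢ` of `C_i` to those of `𝒞_h`, so `C_i ≅ 𝒞_h`.

Both cases are instances of one lemma (`tropicalLinks_adjoin_forall_prime_regular_of_injective`): for
an injective `k`-algebra map `φ : C → K` and a family `y : ι → C`,
`k[X_ι] ⧸ ker (aeval y) ≃ k[φ ∘ y] ⊆ K`, and regularity at all primes is transported along ring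
isomorphisms by the landed `tropicalLinks_forall_prime_regular_of_ringEquiv`.
-/

-- single-problem summit: the doubled namespace component `ResolutionOfSingularities` is forced
set_option linter.dupNamespace false

namespace Summit.ResolutionOfSingularities.ResolutionOfSingularities.Theorems

/-- **Presentation transfer.** For an injective `k`-algebra map `φ : C →ₐ[k] K`, a family `y : ι → C`
and `y' = φ ∘ y`, the quotient `MvPolynomial ι k ⧸ ker (aeval y)` is ring-isomorphic to the subalgebra
`Algebra.adjoin k (Set.range y') ⊆ K` (both are `≅ k[y]`: `aeval y' = φ ∘ aeval y` has the same
kernel as `aeval y`, and its range is the adjoin); hence if the former is regular at all primes, so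
is the latter. [folklore] -/
theorem tropicalLinks_adjoin_forall_prime_regular_of_injective {k C K ι : Type} [CommRing k]
    [CommRing C] [CommRing K] [Algebra k C] [Algebra k K] (φ : C →ₐ[k] K)
    (hφ : Function.Injective φ) (y : ι → C) (y' : ι → K) (hy : ∀ j, φ (y j) = y' j)
    (hreg : ∀ (P : Ideal (MvPolynomial ι k ⧸
      RingHom.ker (MvPolynomial.aeval y : MvPolynomial ι k →ₐ[k] C))) [P.IsPrime],
      IsRegularLocalRing (Localization.AtPrime P)) :
    ∀ (Q : Ideal ↥(Algebra.adjoin k (Set.range y'))) [Q.IsPrime],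
      IsRegularLocalRing (Localization.AtPrime Q) := by
  -- `aeval y' = φ ∘ aeval y`
  have h1 : (MvPolynomial.aeval y' : MvPolynomial ι k →ₐ[k] K) = φ.comp (MvPolynomial.aeval y) := by
    rw [MvPolynomial.comp_aeval]
    congr 1
    funext j
    exact (hy j).symm
  -- same kernel, by injectivity of `φ`
  have hker : RingHom.ker (MvPolynomial.aeval y : MvPolynomial ι k →ₐ[k] C) =
      RingHom.ker (MvPolynomial.aeval y' : MvPolynomial ι k →ₐ[k] K) := by
    ext p
    simp only [RingHom.mem_ker, h1, AlgHom.comp_apply, map_eq_zero_iff φ hφ]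
  -- the range of `aeval y'` is the adjoin
  have hrange : (MvPolynomial.aeval y' : MvPolynomial ι k →ₐ[k] K).range =
      Algebra.adjoin k (Set.range y') :=
    (Algebra.adjoin_range_eq_range_aeval k y').symm
  exact tropicalLinks_forall_prime_regular_of_ringEquiv
    ((Ideal.quotEquivOfEq hker).trans
      ((Ideal.quotientKerEquivRange (MvPolynomial.aeval y' : MvPolynomial ι k →ₐ[k] K)).toRingEquiv.trans
        (Subalgebra.equivOfEq _ _ hrange).toRingEquiv)) hreg

/-- **The concrete charts of the projective closure are regular** (producer brick DTa). Let `B` be a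
domain generated over the field `k` by `f : Fin n → B` (`aeval f` surjective), `K = Frac B`,
`f' := Fin.cons 1 f`. Assume `B` is regular at all primes and, for every `i`, so is the abstract chart
`C_i = k[X₀ … X_n] ⧸ ker (X₀ ↦ 1/fᵢ, X_{j+1} ↦ fⱼ/fᵢ)` (evaluation into `Localization.Away (f i)`).
Then for every `h` with `f'_h ≠ 0` the chart subalgebra `k[f'_j / f'_h : j] ⊆ K` is regular at all
its primes: for `h = 0` it is the (isomorphic) image of `B`, for `h = i + 1` it is isomorphic to
`C_i` through the injective lift `B[fᵢ⁻¹] → K`. [folklore] -/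
theorem tropicalLinks_projChart_regular :
    ∀ (k : Type) [Field k] (B : Type) [CommRing B] [IsDomain B] [Algebra k B] (K : Type) [Field K] [Algebra B K] [IsFractionRing B K] [Algebra k K] [IsScalarTower k B K] (n : ℕ) (f : Fin n → B), (Function.Surjective (MvPolynomial.aeval f : MvPolynomial (Fin n) k →ₐ[k] B) ∧ (∀ (P : Ideal (B)) [P.IsPrime], IsRegularLocalRing (Localization.AtPrime P)) ∧ ∀ (i : Fin n) (P : Ideal (MvPolynomial (Fin (n + 1)) k ⧸ RingHom.ker (MvPolynomial.aeval (Fin.cons (IsLocalization.Away.invSelf (f i)) (fun j => algebraMap (B) (Localization.Away (f i)) (f j) * IsLocalization.Away.invSelf (f i)) : Fin (n + 1) → Localization.Away (f i)) : MvPolynomial (Fin (n + 1)) k →ₐ[k] Localization.Away (f i)))) [P.IsPrime], IsRegularLocalRing (Localization.AtPrime P)) → ∀ (h : Fin (n + 1)), (Fin.cons (1 : B) f : Fin (n + 1) → B) h ≠ 0 → ∀ (Q : Ideal ↥(Algebra.adjoin k (Set.range fun j : Fin (n + 1) => algebraMap B K ((Fin.cons (1 : B) f : Fin (n + 1) → B)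 j) * (algebraMap B K ((Fin.cons (1 : B) f : Fin (n + 1) → B) h))⁻¹))) [Q.IsPrime], IsRegularLocalRing (Localization.AtPrime Q) := by
  intro k _ B _ _ _ K _ _ _ _ _ n f hyp h
  obtain ⟨hsurj, hregB, hregC⟩ := hyp
  have hinjBK : Function.Injective (algebraMap B K) := IsFractionRing.injective B K
  rcases h.eq_zero_or_eq_succ with rfl | ⟨i, rfl⟩
  · -- the chart `h = 0`: `k[f_j] = im (B → K) ≅ B`
    intro _ Q hQ
    -- `aeval f'` is surjective as `aeval f` is
    have hcomp : ((Fin.cons (1 : B) f : Fin (n + 1) → B) ∘ Fin.succ) = f := funext fun j => by simp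
    have hsurj' : Function.Surjective
        (MvPolynomial.aeval (Fin.cons (1 : B) f : Fin (n + 1) → B) :
          MvPolynomial (Fin (n + 1)) k →ₐ[k] B) := by
      intro b
      obtain ⟨p, rfl⟩ := hsurj b
      exact ⟨MvPolynomial.rename Fin.succ p, by rw [MvPolynomial.aeval_rename, hcomp]⟩
    -- so `k[X₀ … X_n] ⧸ ker (aeval f') ≅ B` is regular at all primes
    have hregQ : ∀ (P : Ideal (MvPolynomial (Fin (n + 1)) k ⧸
        RingHom.ker (MvPolynomial.aeval (Fin.cons (1 : B) f : Fin (n + 1) → B) :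
          MvPolynomial (Fin (n + 1)) k →ₐ[k] B))) [P.IsPrime],
        IsRegularLocalRing (Localization.AtPrime P) :=
      tropicalLinks_forall_prime_regular_of_ringEquiv
        (Ideal.quotientKerAlgEquivOfSurjective hsurj').symm.toRingEquiv hregB
    refine tropicalLinks_adjoin_forall_prime_regular_of_injective (IsScalarTower.toAlgHom k B K)
      hinjBK (Fin.cons (1 : B) f : Fin (n + 1) → B) _ (fun j => ?_) hregQ Q
    simp
  · -- the chart `h = i + 1`: `C_i ≅ k[f'_j / f_i] ⊆ K` through the lift `B[f_i⁻¹] → K`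
    intro hfi Q hQ
    simp only [Fin.cons_succ] at hfi
    -- the lift `φ : B[f_i⁻¹] →ₐ[k] K`
    have hunit : ∀ y : Submonoid.powers (f i), IsUnit ((IsScalarTower.toAlgHom k B K) y) := by
      intro y
      obtain ⟨m, hm⟩ := (Submonoid.mem_powers_iff _ _).mp y.2
      simp only [IsScalarTower.coe_toAlgHom', ← hm, map_pow]
      exact IsUnit.pow m (isUnit_iff_ne_zero.mpr ((map_ne_zero_iff _ hinjBK).mpr hfi))
    let φ : Localization.Away (f i) →ₐ[k] K :=
      IsLocalization.liftAlgHom (M := Submonoid.powers (f i)) hunit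
    have hφalg : ∀ b : B, φ (algebraMap B (Localization.Away (f i)) b) = algebraMap B K b :=
      fun b => IsLocalization.lift_eq hunit b
    -- `φ` is injective: `B → B[f_i⁻¹]` and `B → K` are both injective
    have hφinj : Function.Injective φ := by
      show Function.Injective
        (IsLocalization.liftAlgHom (M := Submonoid.powers (f i)) hunit : Localization.Away (f i) →ₐ[k] K)
      rw [IsLocalization.coe_liftAlgHom, IsLocalization.lift_injective_iff]
      intro a b
      constructor
      · intro hab
        rw [IsLocalization.injective (Localization.Away (f i))
          (powers_le_nonZeroDivisors_of_noZeroDivisors hfi) hab]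
      · intro hab
        exact congrArg _ (hinjBK hab)
    -- `φ (1/f_i) = (f_i)⁻¹`
    have hφinv : φ (IsLocalization.Away.invSelf (f i)) = (algebraMap B K (f i))⁻¹ := by
      apply eq_inv_of_mul_eq_one_left
      rw [← hφalg (f i), ← map_mul, mul_comm, IsLocalization.Away.mul_invSelf, map_one]
    refine tropicalLinks_adjoin_forall_prime_regular_of_injective φ hφinj
      (Fin.cons (IsLocalization.Away.invSelf (f i))
        (fun j => algebraMap (B) (Localization.Away (f i)) (f j) * IsLocalization.Away.invSelf (f i)) :
          Fin (n + 1) → Localization.Away (f i)) _ (fun j => ?_) (hregC i) Q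
    refine Fin.cases ?_ (fun j => ?_) j
    · simp only [Fin.cons_zero, Fin.cons_succ, hφinv, map_one, one_mul]
    · simp only [Fin.cons_succ, map_mul, hφalg, hφinv]

end Summit.ResolutionOfSingularities.ResolutionOfSingularities.Theorems
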